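import Literature.MathematicalPhysics.QuantumFieldTheory.Balaban1983to89.B12Normalization

/-!
# `BalabanUV.Beta.FP.HorizontalEndMean` — road «FP» for binder row D1, the MEAN twin of `FP/HorizontalEnd` (owner ruling R-FP-19,
# `HOME/b2b-balaban-beta-d1-p3/OWNER-RULINGS-FP-5.md` v1.2): leading asymptotics of the windowed germ + mean bookkeeping give the MEAN one-shot law,
# and the step law then pins the value EXACTLY — the grading in which road FP's analytic rows need only `o(log n)` control

HONEST DEPENDENCY (page 1, mandatory): continuum YM on T⁴ ⇐ BetaPertH ∧ nine spine estimates (0/9 proved); BetaPertH ⇐ (D1) ∧ (D4) ∧ CAP+tail;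
G-an2-4 gates asym, D1 and NE2/3/4.  HONEST FRAMING (cell contract, verbatim): «discharging `BetaPertH` makes Bałaban's UV stability UNCONDITIONAL —
a real constructive-QFT result; it is NOT the continuum limit and NOT the Clay problem.»  THIS MODULE DISCHARGES NOTHING of the wall: pure real analysis
(Mathlib + the tree's `B12Normalization.stepBal_eq` for the name of the slope); every analytic input is a HYPOTHESIS with its supplier named; no `def`, no
`def … : Prop`, no cited fact, 0 sorry; 0 wall binders; NOT D1, NOT BetaPertH, NOT continuum, NOT Clay.

ABSOLUTE RULE (cell charter, verbatim): «No internally-minted statement may enter as a cited fact. Every hypothesis is either kernel-proved in this package or a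
verbatim quotation of a PUBLISHED theorem with page reference. The manuscript(s) under audit are NOT citable for their own disputed steps — they are the thing
under adjudication; programme-internal (2001/route/tribunal) claims are never citable.»

THE SHAPE (R-FP-19: the MEAN form is road FP's binding target).  `f m` := the perfect `m`-fold coefficient (the one shot at blocking `n = L^m`), `g R` := the windowed
second moment `M₂[Π^{BF}·1_{‖z‖≤R}]`, `s` := the slope.  Hypotheses, both in MEAN grading:
* `hbook` — (H′1)+(H′3) mean form: `(f m − g(L^m))/m → 0` (rows H′2-IR / H′3 need only `o(log n)` control);
* `hgerm` — (H2-c) leading coefficient only: `g R / log R → s` as `R → ∞`.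
CONCLUSIONS: `tendsto_div_of_horizontal_mean` — `f m / m → s·log L`; `tendsto_div_of_horizontal_mean_stepBal` — at `s := 11N²/(12π²)` the limit is `stepBal N L`
(`B12Normalization.stepBal_eq`) = the `(ASYMP)`-mean input of `FixedPointIdentification.value_eq_stepBal_of_step_law_littleO`'s shape; `value_of_horizontal_mean_step` —
with (STEP) `f (m+1) = f m + f 1` the EXACT value `f 1 = s·log L` («uniqueness does the identification»: at the fixed point no uniform bound is needed, only the leading
coefficient); `value_of_horizontal_mean_step_stepBal` — `f 1 = stepBal N L`.
Provenance: road FP owner b2b-balaban-beta-d1-p3 gen 5 (prover-b2b-balaban-beta-d1-p3-g5-0), 2026-08-20.  [folklore], 0 def, 0 cite, 0 sorry.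
v1.1 (same gen): §5 appended — the step law with a BOUNDED DEFECT (the fixed-point reading of the row's (SDF-Σ) clause) still pins `f 1` in MEAN grading
(`value_of_horizontal_mean_defectedStep{,_stepBal}`); every v1 declaration byte-identical.
-/

namespace Summit.QuantumFields.BalabanUV.Beta.FP.HorizontalEndMean

open Filter Topology
open Literature.MathematicalPhysics.QuantumFieldTheory.Balaban1983to89
open B12Normalization (stepBal stepBal_eq)

/-- [folklore] `L^m → ∞` in `ℝ` for `2 ≤ L`. -/
theorem tendsto_pow_natCast {L : ℕ} (hL : 2 ≤ L) : Tendsto (fun m : ℕ => ((L : ℝ)) ^ m) atTop atTop :=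
  tendsto_pow_atTop_atTop_of_one_lt (by exact_mod_cast (lt_of_lt_of_le one_lt_two hL))

/-- [folklore] **THE MEAN END OF THE HORIZONTAL ROUTE**: `(f m − g(L^m))/m → 0` and `g R / log R → s` ⟹ `f m / m → s·log L` (`2 ≤ L`). -/
theorem tendsto_div_of_horizontal_mean {f : ℕ → ℝ} {g : ℝ → ℝ} {s : ℝ} {L : ℕ} (hL : 2 ≤ L)
    (hbook : Tendsto (fun m : ℕ => (f m - g ((L : ℝ) ^ m)) / m) atTop (𝓝 0))
    (hgerm : Tendsto (fun R : ℝ => g R / Real.log R) atTop (𝓝 s)) :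
    Tendsto (fun m : ℕ => f m / m) atTop (𝓝 (s * Real.log L)) := by
  have hL1 : (1 : ℝ) < (L : ℝ) := by exact_mod_cast (lt_of_lt_of_le one_lt_two hL)
  have hlog : 0 < Real.log (L : ℝ) := Real.log_pos hL1
  -- `g(L^m)/log(L^m) → s`
  have h1 : Tendsto (fun m : ℕ => g ((L : ℝ) ^ m) / Real.log ((L : ℝ) ^ m)) atTop (𝓝 s) :=
    hgerm.comp (tendsto_pow_natCast hL)
  -- hence `g(L^m)/m = (g(L^m)/log(L^m))·log L → s·log L`
  have h2 : Tendsto (fun m : ℕ => g ((L : ℝ) ^ m) / m) atTop (𝓝 (s * Real.log L)) := by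
    have h2' : Tendsto (fun m : ℕ => g ((L : ℝ) ^ m) / Real.log ((L : ℝ) ^ m) * Real.log L) atTop (𝓝 (s * Real.log L)) :=
      h1.mul tendsto_const_nhds
    refine h2'.congr' ?_
    filter_upwards [eventually_ge_atTop 1] with m hm
    have hm0 : (m : ℝ) ≠ 0 := by exact_mod_cast (by omega : m ≠ 0)
    rw [Real.log_pow, div_mul_eq_mul_div, mul_div_mul_right _ _ hlog.ne']
  -- sum
  have h3 : Tendsto (fun m : ℕ => (f m - g ((L : ℝ) ^ m)) / m + g ((L : ℝ) ^ m) / m) atTop (𝓝 (0 + s * Real.log L)) :=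
    hbook.add h2
  rw [zero_add] at h3
  refine h3.congr' ?_
  filter_upwards [eventually_ge_atTop 1] with m hm
  ring

/-- [folklore] **THE SAME, IN THE CELL's CURRENCY**: at the slope `s := 11N²/(12π²)` the mean one-shot law reads `f m / m → stepBal N L`
(`B12Normalization.stepBal_eq`). -/
theorem tendsto_div_of_horizontal_mean_stepBal {f : ℕ → ℝ} {g : ℝ → ℝ} (N : ℝ) {Lc : ℕ} (hLc : 2 ≤ Lc)
    (hbook : Tendsto (fun m : ℕ => (f m - g ((Lc : ℝ) ^ m)) / m) atTop (𝓝 0))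
    (hgerm : Tendsto (fun R : ℝ => g R / Real.log R) atTop (𝓝 (11 * N ^ 2 / (12 * Real.pi ^ 2)))) :
    Tendsto (fun m : ℕ => f m / m) atTop (𝓝 (stepBal N Lc)) := by
  rw [stepBal_eq]
  exact tendsto_div_of_horizontal_mean hLc hbook hgerm

/-- [folklore] **EXACTNESS FROM (STEP)** («uniqueness does the identification», mean grading): if moreover `f (m+1) = f m + f 1` for `m ≥ 1`, then `f m = m·f 1`,
so `f m / m = f 1` is constant and the mean law forces `f 1 = s·log L` EXACTLY. -/
theorem value_of_horizontal_mean_step {f : ℕ → ℝ} {g : ℝ → ℝ} {s : ℝ} {L : ℕ} (hL : 2 ≤ L)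
    (hbook : Tendsto (fun m : ℕ => (f m - g ((L : ℝ) ^ m)) / m) atTop (𝓝 0))
    (hgerm : Tendsto (fun R : ℝ => g R / Real.log R) atTop (𝓝 s))
    (hstep : ∀ m : ℕ, 1 ≤ m → f (m + 1) = f m + f 1) :
    f 1 = s * Real.log L := by
  have hmean := tendsto_div_of_horizontal_mean hL hbook hgerm
  have hpow : ∀ m : ℕ, 1 ≤ m → f m = (m : ℝ) * f 1 := by
    intro m hm
    induction m with
    | zero => omega
    | succ k ih =>
      rcases Nat.eq_zero_or_pos k with hk | hk
      · subst hk; simp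
      · rw [hstep k hk, ih hk]; push_cast; ring
  -- `f m / m = f 1` eventually, so the limit is `f 1`
  have hconst : Tendsto (fun m : ℕ => f m / m) atTop (𝓝 (f 1)) := by
    refine (tendsto_const_nhds (x := f 1)).congr' ?_
    filter_upwards [eventually_ge_atTop 1] with m hm
    have hm0 : (m : ℝ) ≠ 0 := by exact_mod_cast (by omega : m ≠ 0)
    rw [hpow m hm]; field_simp
  exact tendsto_nhds_unique hconst hmean

/-- [folklore] The cell's currency: (STEP) + the mean horizontal route ⟹ `f 1 = stepBal N Lc`. -/
theorem value_of_horizontal_mean_step_stepBal {f : ℕ → ℝ} {g : ℝ → ℝ} (N : ℝ) {Lc : ℕ} (hLc : 2 ≤ Lc)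
    (hbook : Tendsto (fun m : ℕ => (f m - g ((Lc : ℝ) ^ m)) / m) atTop (𝓝 0))
    (hgerm : Tendsto (fun R : ℝ => g R / Real.log R) atTop (𝓝 (11 * N ^ 2 / (12 * Real.pi ^ 2))))
    (hstep : ∀ m : ℕ, 1 ≤ m → f (m + 1) = f m + f 1) :
    f 1 = stepBal N Lc := by
  rw [stepBal_eq]
  exact value_of_horizontal_mean_step hLc hbook hgerm hstep

/-- [folklore] CONVERSELY the O(1) forms of `FP/HorizontalEnd` imply the mean forms: a bounded defect is `o(m)` (so the O(1) route is the stretch target, the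
mean route the binding one). -/
theorem tendsto_div_natCast_of_bounded {h : ℕ → ℝ} {U : ℝ} (hU : ∀ m : ℕ, 1 ≤ m → |h m| ≤ U) :
    Tendsto (fun m : ℕ => h m / m) atTop (𝓝 0) := by
  have hU0 : 0 ≤ U := le_trans (abs_nonneg _) (hU 1 le_rfl)
  refine squeeze_zero_norm' ?_ (tendsto_const_div_atTop_nhds_zero_nat U)
  filter_upwards [eventually_ge_atTop 1] with m hm
  have hm0 : (0 : ℝ) < m := by exact_mod_cast (by omega : 0 < m)
  rw [Real.norm_eq_abs, abs_div, abs_of_pos hm0]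
  exact div_le_div_of_nonneg_right (hU m hm) hm0.le

/-! ## §5 (v1.1) The step law may carry a BOUNDED DEFECT — the (SDF-Σ) grading of the row END (an2-g22 `RowD1TelescopingBounded`, referee #92) -/

/-- [folklore] **EXACTNESS FROM A DEFECTED STEP LAW, MEAN GRADING**: if `|f m − m·f 1| ≤ D` for `m ≥ 1` (a bounded step defect — the fixed-point reading of the
row's re-cut telescoping clause (SDF-Σ)) and the mean horizontal route gives `f m / m → s·log L`, then STILL `f 1 = s·log L` exactly. -/
theorem value_of_horizontal_mean_defectedStep {f : ℕ → ℝ} {g : ℝ → ℝ} {s D : ℝ} {L : ℕ} (hL : 2 ≤ L)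
    (hbook : Tendsto (fun m : ℕ => (f m - g ((L : ℝ) ^ m)) / m) atTop (𝓝 0))
    (hgerm : Tendsto (fun R : ℝ => g R / Real.log R) atTop (𝓝 s))
    (hdef : ∀ m : ℕ, 1 ≤ m → |f m - (m : ℝ) * f 1| ≤ D) :
    f 1 = s * Real.log L := by
  have hmean := tendsto_div_of_horizontal_mean hL hbook hgerm
  -- `(f m − m·f 1)/m → 0`, hence `f m / m → f 1`
  have hdef0 : Tendsto (fun m : ℕ => (f m - (m : ℝ) * f 1) / m) atTop (𝓝 0) := tendsto_div_natCast_of_bounded hdef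
  have hsum : Tendsto (fun m : ℕ => (f m - (m : ℝ) * f 1) / m + f 1) atTop (𝓝 (0 + f 1)) := hdef0.add tendsto_const_nhds
  rw [zero_add] at hsum
  have hconst : Tendsto (fun m : ℕ => f m / m) atTop (𝓝 (f 1)) := by
    refine hsum.congr' ?_
    filter_upwards [eventually_ge_atTop 1] with m hm
    have hm0 : (m : ℝ) ≠ 0 := by exact_mod_cast (by omega : m ≠ 0)
    field_simp
    ring
  exact tendsto_nhds_unique hconst hmean

/-- [folklore] The cell's currency: defected step law + the mean horizontal route ⟹ `f 1 = stepBal N Lc`. -/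
theorem value_of_horizontal_mean_defectedStep_stepBal {f : ℕ → ℝ} {g : ℝ → ℝ} {D : ℝ} (N : ℝ) {Lc : ℕ} (hLc : 2 ≤ Lc)
    (hbook : Tendsto (fun m : ℕ => (f m - g ((Lc : ℝ) ^ m)) / m) atTop (𝓝 0))
    (hgerm : Tendsto (fun R : ℝ => g R / Real.log R) atTop (𝓝 (11 * N ^ 2 / (12 * Real.pi ^ 2))))
    (hdef : ∀ m : ℕ, 1 ≤ m → |f m - (m : ℝ) * f 1| ≤ D) :
    f 1 = stepBal N Lc := by
  rw [stepBal_eq]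
  exact value_of_horizontal_mean_defectedStep hLc hbook hgerm hdef

end Summit.QuantumFields.BalabanUV.Beta.FP.HorizontalEndMean
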